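/-
Copyright (c) 2026 the pub-hodgecm-mathlib formalisation cell (harness21).  Prover seat hodgecm-mathlib-K2E5-p17 (g3) (free E5 hand on the E3 road),
Track B «K2-LIT» ∕ h413 (`stmt-HodgeConjecture-24833`), line `K2_E3_EllipticInputs`, unit U12-d, §L road «U-iso-T», brick (G⁺-b) LINE SIDE, part 4:
the unramified quadratic character as a sign weight, and (T1)∕(T2) in the `QuasiChar` currency (unramified case).  2026-09-04.
-/
import Summits.HodgeConjecture.HodgeConjecture.Theorems.K2E3LocalFieldQuadraticCharLineInversion   -- ★ part 3 (p857401): (T1), (T2) for a sign weight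
import HarnessLib

/-!
# K2_E3 road (h413), §L — (G⁺-b) line side, part 4: the `QuasiChar` currency, unramified case

Cell `pub/hodgecm-mathlib` (D-0151), Track B, seat K2E5-p17 (g3) ((G⁺-b) cut with K2E5-p10 (g4), §L lead K2E3-p12 (g4)); frozen interface K2 bus 04:26:40Z
(currency `χ : QuasiChar F`, `χ̃ := Function.extend Units.val (fun u => ((χ u : ℂˣ) : ℂ)) 0`, ★ `TateDirect.extend_*`).  `--supports stmt-HodgeConjecture-24833
--as helper`; THEOREMS ONLY.  COUNT-NEUTRAL.

For a quadratic (`χ u * χ u = 1`), non-trivial, UNRAMIFIED quasi-character `χ` of a non-archimedean local field `F`: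
* §1 `χ̃` satisfies the sign-weight frame of parts 1–3: measurable (★), `‖χ̃‖ ≤ 1`, `χ̃ 0 = 0` (★), `χ(ϖ) = −1` (`coe_apply_uniformizer_eq_neg_one`), hence `χ̃ = (−1)^j` on the
  shell `j` (`extend_eq_neg_one_zpow_of_mem_shell`);
* §2 **(T1) `integral_extend_mul_fourierSB_eq_of_isUnramified`**: `∫ χ̃ Ĝ dμ = γ₀ (Z₀(G) + c₀ G(0))`, `γ₀ = 2(−1)^m μ(𝔭^m)∕(1+q⁻¹)`, `c₀ = (1−q⁻¹)μ(𝒪)∕2`;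
  **(T2) `setIntegral_compl_primePowBall_even_eventually_eq_of_isUnramified`**: `∀ᶠ n, ∫_{(𝔭^{2n})ᶜ} χ̃ ‖·‖⁻¹ G = Z₀(G)` (strict set, ERRATUM 04:38:32Z).
The ramified case ((T1) with `γ₀` the Gauss sum and `c₀ = 0`; (T2) for every truncation) is part 5.
[Tate1950, §2.3, §2.5] [BushnellHenniart2006, §23.5].
HONEST LABEL: HC_CM is proved only modulo the 7 printed citations (2 remaining named inputs: hLiu418 = stmt-HodgeConjecture-24832, h413 = stmt-HodgeConjecture-24833)
until rung 0 closes; count-neutral.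
-/

set_option autoImplicit false
set_option linter.dupNamespace false   -- `Summit.HodgeConjecture.HodgeConjecture.…` (D-0017 nested layout; lakefile exemption for Summits)

noncomputable section

open MeasureTheory Measure Filter Topology Set
open scoped NNReal ENNReal Pointwise
open Literature.NumberTheory.Automorphic Literature.NumberTheory.Automorphic.LocalFieldHaar Literature.NumberTheory.Automorphic.TateDirect
open Literature.NumberTheory.GaloisRepresentations Literature.NumberTheory.GaloisRepresentations.IsNonarchimedeanLocalField
open Summit.HodgeConjecture.HodgeConjecture.Cruxes.H413.K2E3LocalFieldQuadraticCharLineInversion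

namespace Summit.HodgeConjecture.HodgeConjecture.Cruxes.H413.K2E3LocalFieldQuadraticCharSignWeight

variable {F : Type*} [Field F] [ValuativeRel F] [TopologicalSpace F] [IsNonarchimedeanLocalField F]

/-! ## §1  The unramified quadratic character as a sign weight -/

omit [ValuativeRel F] [IsNonarchimedeanLocalField F] in
/-- A quadratic quasi-character is unitary, so `‖χ̃ x‖ ≤ 1` everywhere. [cite: Tate1950, §2.3] -/
theorem norm_extend_le_one (χ : QuasiChar F) (hχ2 : ∀ u, χ u * χ u = 1) (x : F) :
    ‖Function.extend ((↑) : Fˣ → F) (fun u => ((χ u : ℂˣ) : ℂ)) 0 x‖ ≤ 1 := by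
  by_cases hx : x = 0
  · subst hx
    rw [extend_apply_zero]
    simp
  · rw [extend_apply_of_ne_zero χ hx]
    have h : ((χ (Units.mk0 x hx) : ℂˣ) : ℂ) * ((χ (Units.mk0 x hx) : ℂˣ) : ℂ) = 1 := by
      rw [← Units.val_mul, hχ2, Units.val_one]
    have h1 : ‖((χ (Units.mk0 x hx) : ℂˣ) : ℂ)‖ * ‖((χ (Units.mk0 x hx) : ℂˣ) : ℂ)‖ = 1 := by
      rw [← norm_mul, h, norm_one]
    nlinarith [norm_nonneg ((χ (Units.mk0 x hx) : ℂˣ) : ℂ)]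

/-- A quadratic quasi-character has exponent `0` (is unitary). [cite: Tate1950, §2.3] -/
theorem hasExponent_zero (χ : QuasiChar F) (hχ2 : ∀ u, χ u * χ u = 1) : χ.HasExponent 0 := by
  intro u
  rw [Real.rpow_zero]
  have h : ((χ u : ℂˣ) : ℂ) * ((χ u : ℂˣ) : ℂ) = 1 := by rw [← Units.val_mul, hχ2, Units.val_one]
  have h1 : ‖((χ u : ℂˣ) : ℂ)‖ * ‖((χ u : ℂˣ) : ℂ)‖ = 1 := by rw [← norm_mul, h, norm_one]
  nlinarith [norm_nonneg ((χ u : ℂˣ) : ℂ)]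

/-- **`χ(ϖ) = −1`** for a quadratic, non-trivial, unramified `χ`: `χ(ϖ)^2 = 1`, and `χ(ϖ) = 1` would force `χ̃ ≡ 1` off `0` (★ `extend_eq_pow_of_mem_shell`), i.e. `χ = 1`.
[cite: Tate1950, §2.3] -/
theorem coe_apply_uniformizer_eq_neg_one (χ : QuasiChar F) (hχ : χ.IsUnramified) (hχ2 : ∀ u, χ u * χ u = 1) (hχ1 : ∃ u, χ u ≠ 1)
    {ϖ : F} (hϖ : normAbs F ϖ = (residueFieldCard F : ℝ≥0)⁻¹) (hϖ0 : ϖ ≠ 0) :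
    ((χ (Units.mk0 ϖ hϖ0) : ℂˣ) : ℂ) = -1 := by
  have hsq : ((χ (Units.mk0 ϖ hϖ0) : ℂˣ) : ℂ) * ((χ (Units.mk0 ϖ hϖ0) : ℂˣ) : ℂ) = 1 := by
    rw [← Units.val_mul, hχ2, Units.val_one]
  rcases mul_self_eq_one_iff.1 hsq with h1 | h1
  · exfalso
    obtain ⟨u, hu⟩ := hχ1
    apply hu
    obtain ⟨k, hk⟩ := exists_normAbs_eq_inv_zpow u.ne_zero
    have hshell : (u : F) ∈ primePowBall F k \ primePowBall F (k + 1) := by rw [mem_shell_iff, hk]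
    have h2 := extend_eq_pow_of_mem_shell hχ hϖ hshell
    rw [extend_apply_coe, h1, one_zpow] at h2
    exact Units.val_eq_one.1 h2
  · exact h1

/-- For a quadratic, non-trivial, unramified `χ`: **`χ̃ = (−1)^j` on the shell `j`**. [cite: Tate1950, §2.3] -/
theorem extend_eq_neg_one_zpow_of_mem_shell (χ : QuasiChar F) (hχ : χ.IsUnramified) (hχ2 : ∀ u, χ u * χ u = 1) (hχ1 : ∃ u, χ u ≠ 1)
    {ϖ : F} (hϖ : normAbs F ϖ = (residueFieldCard F : ℝ≥0)⁻¹) (j : ℤ) (x : F) (hx : x ∈ primePowBall F j \ primePowBall F (j + 1)) :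
    Function.extend ((↑) : Fˣ → F) (fun u => ((χ u : ℂˣ) : ℂ)) 0 x = (-1) ^ j := by
  have hϖ0 : ϖ ≠ 0 := by rintro rfl; rw [map_zero] at hϖ; exact inv_residueFieldCard_pos.ne hϖ
  rw [extend_eq_pow_of_mem_shell hχ hϖ hx, coe_apply_uniformizer_eq_neg_one χ hχ hχ2 hχ1 hϖ hϖ0]

/-! ## §2  (T1) and (T2) in the `QuasiChar` currency, unramified case -/

section LineInversion
variable [MeasurableSpace F] [BorelSpace F] (μ : Measure F) [μ.IsAddHaarMeasure]
  (χ : QuasiChar F) (hχ : χ.IsUnramified) (hχ2 : ∀ u, χ u * χ u = 1) (hχ1 : ∃ u, χ u ≠ 1)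
  (ψ : AddChar F Circle) (hψc : Continuous ψ) {m : ℤ} (hm : ψ.HasConductorExp m)

open scoped Classical in
include hχ hχ2 hχ1 hψc hm in
/-- **(T1), unramified quadratic `χ`.**  For every Schwartz–Bruhat `G`,
`∫ χ̃(t) Ĝ(t) dμ = γ₀ · (Z₀(G) + c₀ · G 0)`, `γ₀ = 2(−1)^m μ(𝔭^m)∕(1+q⁻¹)`, `c₀ = (1−q⁻¹)μ(𝒪)∕2`,
`Z₀(G) = ∫ χ̃(s) ‖s‖⁻¹ (G s − 1_𝒪(s) G 0) dμ`. [cite: Tate1950, §2.5] [cite: BushnellHenniart2006, §23.5] -/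
theorem integral_extend_mul_fourierSB_eq_of_isUnramified {G : F → ℂ} (hG : G ∈ SchwartzBruhat F) :
    ∫ t, Function.extend ((↑) : Fˣ → F) (fun u => ((χ u : ℂˣ) : ℂ)) 0 t * fourierSB ψ μ G t ∂μ =
      (2 * (-1) ^ m * (μ.real (primePowBall F m) : ℂ) / (1 + (residueFieldCard F : ℂ)⁻¹)) *
        ((∫ s, Function.extend ((↑) : Fˣ → F) (fun u => ((χ u : ℂˣ) : ℂ)) 0 s * ((((normAbs F s)⁻¹ : ℝ≥0) : ℝ) : ℂ) *
            (G s - (primePowBall F 0).indicator (fun _ => G 0) s) ∂μ) +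
          ((1 - (residueFieldCard F : ℂ)⁻¹) * (μ.real (primePowBall F 0) : ℂ) / 2) * G 0) := by
  obtain ⟨ϖ, _, hϖ⟩ := exists_normAbs_eq_inv (F := F)
  exact integral_sign_mul_fourierSB_eq μ (measurable_extend χ) (norm_extend_le_one χ hχ2)
    (extend_eq_neg_one_zpow_of_mem_shell χ hχ hχ2 hχ1 hϖ) (extend_apply_zero χ) hϖ ψ hψc hm hG

open scoped Classical in
include hχ hχ2 hχ1 hψc hm in
/-- **(T1), `∃ γ₀ c₀` form**, unramified quadratic `χ` (the frozen (G⁺-b) interface, unramified places). [cite: Tate1950, §2.5] -/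
theorem exists_lineInversion_consts_of_isUnramified :
    ∃ γ₀ c₀ : ℂ, ∀ G ∈ SchwartzBruhat F,
      ∫ t, Function.extend ((↑) : Fˣ → F) (fun u => ((χ u : ℂˣ) : ℂ)) 0 t * fourierSB ψ μ G t ∂μ =
        γ₀ * ((∫ s, Function.extend ((↑) : Fˣ → F) (fun u => ((χ u : ℂˣ) : ℂ)) 0 s * ((((normAbs F s)⁻¹ : ℝ≥0) : ℝ) : ℂ) *
            (G s - (primePowBall F 0).indicator (fun _ => G 0) s) ∂μ) + c₀ * G 0) :=
  ⟨_, _, fun _ hG => integral_extend_mul_fourierSB_eq_of_isUnramified μ χ hχ hχ2 hχ1 ψ hψc hm hG⟩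

open scoped Classical in
include hχ hχ2 hχ1 in
/-- **(T2), unramified quadratic `χ`.**  Eventually in `n`, `∫_{(𝔭^{2n})ᶜ} χ̃(s) ‖s‖⁻¹ G(s) dμ = Z₀(G)` exactly. [cite: Tate1950, §2.5] -/
theorem setIntegral_compl_primePowBall_even_eventually_eq_of_isUnramified {G : F → ℂ} (hG : G ∈ SchwartzBruhat F) :
    ∀ᶠ n : ℕ in atTop, ∫ s in (primePowBall F (2 * n : ℤ))ᶜ,
        Function.extend ((↑) : Fˣ → F) (fun u => ((χ u : ℂˣ) : ℂ)) 0 s * ((((normAbs F s)⁻¹ : ℝ≥0) : ℝ) : ℂ) * G s ∂μ =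
      ∫ s, Function.extend ((↑) : Fˣ → F) (fun u => ((χ u : ℂˣ) : ℂ)) 0 s * ((((normAbs F s)⁻¹ : ℝ≥0) : ℝ) : ℂ) *
        (G s - (primePowBall F 0).indicator (fun _ => G 0) s) ∂μ := by
  obtain ⟨ϖ, _, hϖ⟩ := exists_normAbs_eq_inv (F := F)
  exact setIntegral_compl_primePowBall_even_eventually_eq μ (measurable_extend χ) (norm_extend_le_one χ hχ2)
    (extend_eq_neg_one_zpow_of_mem_shell χ hχ hχ2 hχ1 hϖ) hG

end LineInversion

end Summit.HodgeConjecture.HodgeConjecture.Cruxes.H413.K2E3LocalFieldQuadraticCharSignWeight
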